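import Summits.QuantumFields.YangMills.Theorems.BalabanUVNodesN13UVRowOfUpperAndSmallLocus

/-!
# BalabanUVNodes ∕ N13 — THE (UV₁₃) ROW `hUV` FROM [III] COR. 3's LEAVES ON THE RECORD's HISTORIES WITH (L2) RESTRICTED TO THE SMALL LOCUS: (U1) ∕ (U2) everywhere,
# (L2ˢ) = the all-small term's lower bound ONLY at configurations all of whose `b₀`-free plaquettes are `(2εreg + 4ε₂₉)`-small; leaves (H) and (L1) are theorems at the
# record, the large-field part of the lower half is sign bookkeeping (p593634)

Cell `pub-ymgap` (HUMAN RULING D-0062 Track A; D-0149 width seat `pub-ymgap-dag-n13-w1`, g2, INTENT-5), key K1⁷ `StabilityBAtRecordR13SepCoPH` = stmt-QuantumFields-20542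
(`--kind proof --supports … --as helper`).  [III] = [Balaban1988Convergent], [B16] = [Balaban1989LargeFieldII], [Av] = [Balaban1985Averaging].

WHY.  dag-n13-w3's socket (p592785 ∕ p594664 `hUV₁₃CoPH_of_U1_U2_L2`) prices N13's (UV₁₃) row `hUV` at THREE displayed leaves on the record's own (2.18) histories: (U1) termwise
majorants, (U2) their sum `≤ exp(E₊|T|)`, (L2) the all-small term's lower bound `χβ_k·exp(−g_k⁻²A^η_k − em|T|) ≤ χ_k(s₀)·slot_k(s₀)` AT EVERY `V` ((H) by construction, (L1) from the ζ-laws).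
p593634 ∕ p595529 showed the lower half is SIGN BOOKKEEPING off the small locus (the (2.9) species vanishes at every `b₀`-free plaquette deviating by `≥ 2εreg + 4ε₂₉`, both branches of
def-B's level-`(k+1)` map, [Av] Prop. 2).  THIS FILE composes the two BY NAME: the engines' `hUV` binder VERBATIM from (U1), (U2) and **(L2ˢ) = (L2) demanded ONLY on the small locus**
`{V : every b₀-free plaquette (2εreg + 4ε₂₉)-small}` — the exact set where `χβ_k` can be non-zero, i.e. where [III] Thm 2's (2.49) is print's input.  One theorem, engines' keying
(`θ : Stage13HParams`, `h : θ.Provisos₁₃CoPH`, `w : WorldP`; numeric side conditions K-uniform, [Av] Prop. 2's range).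

HONEST FRAMING.  Count-neutral by-name composition (p592785's `densOfRecord₁₃_le_of_U1_U2` ∕ `densOfRecord₁₃_eq_sum`, adv3's `B14Cor3.ge_of_sum_repr`, p593634's `histTerm_nonneg`, p595529's
`hUV₁₃_of_upper_of_lowerSmallLocus`); (U1), (U2), (L2ˢ) DISPLAYED — nothing of [B16] Thm 1 ∕ [III] Cor. 3 ∕ Thm 2 claimed; N13 NOT discharged; K0⁷∕K1⁷ NOT closed; counts unmoved (5∕27 · A 5∕28);
one finite `𝕋⁴_{L^K}` programme at fixed `ε = L^{−K}` — R4 closes the conditional finite-𝕋⁴ rung `BalabanLadder.UV` only; the YM mass gap (Clay) is NOT proved by any of this.  No `def`, no `sorry`.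
-/

noncomputable section

open scoped BigOperators Matrix.Norms.L2Operator

namespace Summit.QuantumFields.YangMills.BalabanUVNodes.N13UVRowOfU1U2L2SmallLocus

open Literature.MathematicalPhysics.QuantumFieldTheory.Balaban1983to89
open Literature.MathematicalPhysics.QuantumFieldTheory.Balaban1983to89.T4Continuum (T4Family)
open Literature.MathematicalPhysics.QuantumFieldTheory.Balaban1983to89.Node00
open FlowStepRuns (genFlow)
open DagBinding (WorldP)
open ExpMeanLog (deltaSU)
open Summit.QuantumFields.YangMills.BalabanUVNodes.N13Cor3Repr218LeavesAtRecord13CoPH (densOfRecord₁₃_le_of_U1_U2 densOfRecord₁₃_eq_sum)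
open Summit.QuantumFields.YangMills.BalabanUVNodes.N13UVChiOffSolvableAtRecord13 (histTerm_nonneg)
open Summit.QuantumFields.YangMills.BalabanUVNodes.N13UVRowOfUpperAndSmallLocus (hUV₁₃_of_upper_of_lowerSmallLocus)

variable {F : T4Family} {N : ℕ} [NeZero N]

/-- **★ THE ENGINES' `hUV` BINDER, VERBATIM, FROM (U1) + (U2) + (L2ˢ) — (L2) ONLY ON THE SMALL LOCUS** (engines' keying; `εreg` in [Av] Prop. 2's range): termwise majorants of the
record's (2.18) summands and their sum bound at every `V` (dag-n13-w3's (U1) ∕ (U2) verbatim), and the all-small history term's lower bound demanded ONLY at the configurations all of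
whose `b₀`-free plaquettes are `(2εreg + 4ε₂₉)`-small.  Off that locus the lower half is p593634's sign bookkeeping; (H) and (L1) are theorems at the record.
[cite: Balaban1989LargeFieldII, Thm 1 p.355, (0.1) pp.355–356; Balaban1988Convergent, (2.18) p.257, Cor. 3 (2.50) p.264; Balaban1987RG1, (2.9) p.266; Balaban1985Averaging, Prop. 2 (54) p.26] -/
theorem hUV₁₃CoPH_of_U1_U2_L2small (θ : Stage13HParams F N) (h : θ.Provisos₁₃CoPH F N) (w : WorldP)
    (hε : 0 < θ.ν.εreg) (hε3 : (143 * ((((4 + 4 : ℕ) : ℝ)) ^ 2 / 4) ^ 2) * θ.ν.εreg ≤ 1 / 3)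
    (hε2 : 2 * θ.ν.εreg ≤ 2 * deltaSU (Fin N) / ((((4 + 4) * F.L : ℕ) : ℝ) ^ 2))
    (major : (P : B12.RunParams) → (k : ℕ) → (reprOfRecord₁₃ F N θ.toStage13Params P k).Adm → ℝ)
    (s₀ : (P : B12.RunParams) → (k : ℕ) → (reprOfRecord₁₃ F N θ.toStage13Params P k).Adm)
    (hU1 : ∀ P : B12.RunParams, (genFlow (betaOfRecord₁₃ F N θ.toStage13Params) P.g0).InInterval w.γ P.K → ∀ k, k ≤ P.K → SLaw₁₃CoPH F N θ P k →
      ∀ s V, (reprOfRecord₁₃ F N θ.toStage13Params P k).χ s V * (reprOfRecord₁₃ F N θ.toStage13Params P k).TexpA s V ≤ major P k s)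
    (hU2 : ∀ P : B12.RunParams, (genFlow (betaOfRecord₁₃ F N θ.toStage13Params) P.g0).InInterval w.γ P.K → ∀ k, k ≤ P.K → SLaw₁₃CoPH F N θ P k →
      ∑ s, major P k s ≤ Real.exp (w.ep (gOfRecord₁₃ F N θ.toStage13Params P k) * (Fintype.card (Site (F.P P.K) k) : ℝ)))
    (hL2small : ∀ P : B12.RunParams, (genFlow (betaOfRecord₁₃ F N θ.toStage13Params) P.g0).InInterval w.γ P.K → ∀ k, k ≤ P.K → SLaw₁₃CoPH F N θ P k →
      ∀ V : GaugeField (F.P P.K) k (SU N),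
        (∀ p : Plaq (F.P P.K) k, ¬ IsB0 (F := F) (⟨p.src, p.μ⟩ : PBond (F.P P.K) k) → ¬ IsB0 (F := F) (⟨p.src.shift p.μ, p.ν⟩ : PBond (F.P P.K) k) →
          ¬ IsB0 (F := F) (⟨p.src.shift p.ν, p.μ⟩ : PBond (F.P P.K) k) → ¬ IsB0 (F := F) (⟨p.src, p.ν⟩ : PBond (F.P P.K) k) →
          dist1 (GaugeField.plaqHol V p) < 2 * θ.ν.εreg + 4 * θ.ε₂₉) →
        chiβOfRecord₁₃ F N θ.toStage13Params P.K (gOfRecord₁₃ F N θ.toStage13Params P) k V *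
            Real.exp (-(1 / (gOfRecord₁₃ F N θ.toStage13Params P k) ^ 2 * wilsonBGOfRecord F N θ.εbg P k V)
              - w.em (gOfRecord₁₃ F N θ.toStage13Params P k) * (Fintype.card (Site (F.P P.K) k) : ℝ)) ≤
          (reprOfRecord₁₃ F N θ.toStage13Params P k).χ (s₀ P k) V * (reprOfRecord₁₃ F N θ.toStage13Params P k).TexpA (s₀ P k) V) :
    ∀ P : B12.RunParams, (genFlow (betaOfRecord₁₃ F N θ.toStage13Params) P.g0).InInterval w.γ P.K → ∀ k, k ≤ P.K → SLaw₁₃CoPH F N θ P k →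
      ∀ U : GaugeField (F.P P.K) k (SU N),
        chiβOfRecord₁₃ F N θ.toStage13Params P.K (gOfRecord₁₃ F N θ.toStage13Params P) k U *
              Real.exp (-(1 / (gOfRecord₁₃ F N θ.toStage13Params P k) ^ 2 * wilsonBGOfRecord F N θ.toStage13Params.εbg P k U)
                - w.em (gOfRecord₁₃ F N θ.toStage13Params P k) * (Fintype.card (Site (F.P P.K) k) : ℝ)) ≤ densOfRecord₁₃ F N θ.toStage13Params P k U ∧
        densOfRecord₁₃ F N θ.toStage13Params P k U ≤ Real.exp (w.ep (gOfRecord₁₃ F N θ.toStage13Params P k) * (Fintype.card (Site (F.P P.K) k) : ℝ)) :=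
  hUV₁₃_of_upper_of_lowerSmallLocus θ h w hε hε3 hε2
    (fun P hP k hk hS U => densOfRecord₁₃_le_of_U1_U2 F N θ P k (major P k) _ (hU1 P hP k hk hS) (hU2 P hP k hk hS) U)
    (fun P hP k hk hS U hsmall =>
      B14Cor3.ge_of_sum_repr
        (fun s => (reprOfRecord₁₃ F N θ.toStage13Params P k).χ s U * (reprOfRecord₁₃ F N θ.toStage13Params P k).TexpA s U) (s₀ P k)
        (densOfRecord₁₃_eq_sum F N θ P k U) (fun s => histTerm_nonneg θ.toStage13Params h.zetaUnity h.zetaAbs P k s U) (hL2small P hP k hk hS U hsmall))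

end Summit.QuantumFields.YangMills.BalabanUVNodes.N13UVRowOfU1U2L2SmallLocus

end
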